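import Summits.Parity.GeneralizedHardyLittlewood.Theorems.ZDegreeToeplitzBandLemma81ExtMain
import Literature.NumberTheory.LFunctions.Zhang2022.KnifeEdgeLenLongLegChiWindow
import Literature.NumberTheory.LFunctions.Zhang2022.Section18SjNormSizes

/-!
# Route `ZDegreeToeplitzBand`, crux `PsiGradedTablesClosePoly` (stmt-Parity-22438), line `long_poly_dil`, stub
# `stub_lemma81LongPsiDil` (P2-Dil): the slot `LongLegSplit.Lemma81LongPsiDil` REDUCED TO ITS u014 MEAN SQUARE —
# what remains of stub 3 after the generic two-truncation chain (Parts 1–5)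

Y. Zhang, *Discrete mean estimates and the Landau–Siegel zero*, arXiv:2211.02515v1 — an unrefereed manuscript under
adjudication. **The programme SEARCHES and TYPES; no claim about Landau–Siegel zeros, Theorems 1–2 of arXiv:2211.02515
or a repaired Margin232 until a kernel theorem says so.**

The long ψ-datum `𝐚₁ = longPsiData χ (dilHead D b₀) g f` and the tiny datum `a₂` of the slot enter the generic theorem
`lemma81Ext_of_meanSquare_eventually` (Part 5) with `N₁ = Nlong D ≤ P³`, `N₂ = Nsupp D ≤ P³` and coefficients `≤ P¹⁰`
(`lemma81Dil_norm_longPsiData_le` etc.: crude sizes, `|dilHead D b₀ (d)| ≤ DB·d²`, `|χ(q)g̃(q)| ≤ 1`, `τ(m) ≤ m`). Hence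
(`lemma81LongPsiDil_pointwise_of_meanSquare`): for every large `c′`, every `B` and `ε > 0` there is `K > 0` such that for all
large `D` under (A), for ALL heads/data of the slot's classes, the two mean squares
`Σ_{Ψ₁}|A_{Nlong}(𝐚₁;s)A_{Nsupp}(a₂;1−s)|², `Σ_{Ψ₁}|A_{Nsupp}(ā₂;s)A_{Nlong}(𝐚̄₁;1−s)|² ≤ K·D·P²·𝓛³⁸` on `𝔍(α)` imply the
slot's conclusion `‖lhs81Ext − (Theta1Ext + conj Theta1Ext′)‖ ≤ ε√D𝔓`; and (`lemma81LongPsiDil_of_meanSquare`) the slot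
`∃ c₀ ∀ c′ ≥ c₀, Lemma81LongPsiDil c′` (= stub 3 verbatim) follows from that mean square as an `o(D·P²𝓛³⁸)` statement over
the class. THIS RESIDUAL IS THE FINDING (budget memo BUDGET-P2Dil-g20.md on stmt-Parity-22438): the printed budget leaves
`𝓛³⁸` (two logs above the divisor sum `𝓛³⁶` of (7.2)-data), which divisor-class heads of length `D⁴` overdraw; the cell's own
heads `upsHead`/`nuHead` (class members, `B = 1`) are lacunary at primes under (A) — the mean square for THEM is the
surviving stub. Theorems only; no definitions; no new named facts. Prover: ls-knife-typer-3 g20 (cell landau-siegel §D),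
`--supports` stmt-Parity-22438. [cite: Zhang2022LandauSiegel, §8 Lemma 8.1 pp. 42–44, (8.8); §7 (7.2)]
-/

noncomputable section

open Complex Real Set ComplexConjugate Finset
open Literature.NumberTheory.LFunctions.Zhang2022
open Literature.NumberTheory.LFunctions.Zhang2022.Skeleton
open Literature.NumberTheory.LFunctions.Zhang2022.Section8aStatements
open Literature.NumberTheory.LFunctions.Zhang2022.KnifeEdge
open Literature.NumberTheory.LFunctions.Zhang2022.KnifeEdge.LongLegSplit

namespace Summit.Parity.GeneralizedHardyLittlewood.Theorems

/-! ### Crude sizes of the slot's data -/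

section Sizes

variable {D : ℕ} (χ : DirichletCharacter ℂ D)

/-- `|χ(q)·g(log q/log P)| ≤ 1` for an in-class profile with `|g| ≤ 1` on `[0,1]` (`g = 0` beyond `1`; `log P > 0`).
[cite: Zhang2022LandauSiegel, §8 (8.8); §7 (7.2)] -/
theorem lemma81Dil_norm_profData_le_one (hP : 0 < Real.log (bigP D)) {g g' : ℝ → ℂ} (hg : InClassPiece g g')
    (hg1 : ∀ x ∈ Set.Icc (0:ℝ) 1, ‖g x‖ ≤ 1) (q : ℕ) : ‖profData χ g q‖ ≤ 1 := by
  rw [profData, norm_mul]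
  have hχ : ‖χ (q : ZMod D)‖ ≤ 1 := DirichletCharacter.norm_le_one χ _
  have hy0 : 0 ≤ Real.log q / Real.log (bigP D) := div_nonneg (Real.log_natCast_nonneg q) hP.le
  have hgq : ‖g (Real.log q / Real.log (bigP D))‖ ≤ 1 := by
    by_cases hy : Real.log q / Real.log (bigP D) ≤ 1
    · exact hg1 _ ⟨hy0, hy⟩
    · rw [hg.vanish _ (le_of_lt (not_le.mp hy)), norm_zero]; exact zero_le_one
  calc ‖χ (q : ZMod D)‖ * ‖g (Real.log q / Real.log (bigP D))‖ ≤ 1 * 1 :=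
        mul_le_mul hχ hgq (norm_nonneg _) zero_le_one
    _ = 1 := one_mul _

/-- The divisor-class head, dilated: `|dilHead D b₀ (d)| ≤ D·B·d²` when `|b₀(n)| ≤ B·τ(n)²` (`τ(k) ≤ k`, `d/D ≤ d`).
[cite: Zhang2022LandauSiegel, §8 (8.8); §3 (3.1)] -/
theorem lemma81Dil_norm_dilHead_le {b₀ : ℕ → ℂ} {B : ℝ} (hb₀ : ∀ n, ‖b₀ n‖ ≤ B * ((Nat.divisors n).card : ℝ) ^ 2)
    (d : ℕ) : ‖dilHead D b₀ d‖ ≤ (D : ℝ) * B * (d : ℝ) ^ 2 := by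
  have hB : 0 ≤ B := by
    have h := hb₀ 1
    simp only [Nat.divisors_one, Finset.card_singleton, Nat.cast_one, one_pow, mul_one] at h
    exact (norm_nonneg _).trans h
  unfold dilHead
  split_ifs with hDd
  · rw [norm_mul, Complex.norm_natCast]
    have h1 : ((Nat.divisors (d / D)).card : ℝ) ≤ (d : ℝ) := by
      have := Nat.card_divisors_le_self (d / D)
      have h2 : d / D ≤ d := Nat.div_le_self d D
      exact_mod_cast this.trans h2
    have h3 := hb₀ (d / D)
    calc (D : ℝ) * ‖b₀ (d / D)‖ ≤ (D : ℝ) * (B * ((Nat.divisors (d / D)).card : ℝ) ^ 2) := by gcongr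
      _ ≤ (D : ℝ) * (B * (d : ℝ) ^ 2) := by gcongr
      _ = (D : ℝ) * B * (d : ℝ) ^ 2 := by ring
  · rw [norm_zero]; positivity

/-- **`|𝐚₁(n)| ≤ M·n⁴`** for `𝐚₁ = longPsiData χ b g f` whenever `|b(d)| ≤ M·d²` (`M ≥ 0`) and `|χg̃|, |χf̃| ≤ 1`:
`Σ_{dm=n}|b(d)|·#{q₁q₂ = m} ≤ τ(n)·Mn²·n ≤ M n⁴`. [cite: Zhang2022LandauSiegel, §8 (8.8)] -/
theorem lemma81Dil_norm_longPsiData_le {b : ℕ → ℂ} {g f : ℝ → ℂ} {M : ℝ} (hM : 0 ≤ M)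
    (hb : ∀ d, ‖b d‖ ≤ M * (d : ℝ) ^ 2) (hg : ∀ q, ‖profData χ g q‖ ≤ 1) (hf : ∀ q, ‖profData χ f q‖ ≤ 1)
    (n : ℕ) : ‖longPsiData χ b g f n‖ ≤ M * (n : ℝ) ^ 4 := by
  unfold longPsiData
  have hcardA : ∀ m : ℕ, ((Nat.divisorsAntidiagonal m).card : ℝ) ≤ m := fun m => by
    rw [← Nat.map_div_right_divisors, Finset.card_map]
    exact_mod_cast Nat.card_divisors_le_self m
  have hinner : ∀ m : ℕ, ‖∑ q ∈ Nat.divisorsAntidiagonal m, profData χ g q.1 * profData χ f q.2‖ ≤ m := by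
    intro m
    calc ‖∑ q ∈ Nat.divisorsAntidiagonal m, profData χ g q.1 * profData χ f q.2‖
        ≤ ∑ q ∈ Nat.divisorsAntidiagonal m, ‖profData χ g q.1 * profData χ f q.2‖ := norm_sum_le _ _
      _ ≤ ∑ q ∈ Nat.divisorsAntidiagonal m, (1 : ℝ) := Finset.sum_le_sum fun q _ => by
          rw [norm_mul]
          calc ‖profData χ g q.1‖ * ‖profData χ f q.2‖ ≤ 1 * 1 :=
                mul_le_mul (hg _) (hf _) (norm_nonneg _) zero_le_one
            _ = 1 := one_mul _
      _ = ((Nat.divisorsAntidiagonal m).card : ℝ) := by rw [Finset.sum_const, nsmul_eq_mul, mul_one]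
      _ ≤ m := hcardA m
  have hterm : ∀ p ∈ Nat.divisorsAntidiagonal n,
      ‖b p.1 * ∑ q ∈ Nat.divisorsAntidiagonal p.2, profData χ g q.1 * profData χ f q.2‖ ≤ M * (n : ℝ) ^ 3 := by
    intro p hp
    have hp1 : p.1 ≤ n := Nat.divisor_le (Nat.fst_mem_divisors_of_mem_antidiagonal hp)
    have hp2 : p.2 ≤ n := Nat.divisor_le (Nat.snd_mem_divisors_of_mem_antidiagonal hp)
    rw [norm_mul]
    calc ‖b p.1‖ * ‖∑ q ∈ Nat.divisorsAntidiagonal p.2, profData χ g q.1 * profData χ f q.2‖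
        ≤ (M * (p.1 : ℝ) ^ 2) * (p.2 : ℝ) := mul_le_mul (hb _) (hinner _) (norm_nonneg _) (by positivity)
      _ ≤ (M * (n : ℝ) ^ 2) * (n : ℝ) := by gcongr
      _ = M * (n : ℝ) ^ 3 := by ring
  calc ‖∑ p ∈ Nat.divisorsAntidiagonal n,
        b p.1 * ∑ q ∈ Nat.divisorsAntidiagonal p.2, profData χ g q.1 * profData χ f q.2‖
      ≤ ∑ p ∈ Nat.divisorsAntidiagonal n,
        ‖b p.1 * ∑ q ∈ Nat.divisorsAntidiagonal p.2, profData χ g q.1 * profData χ f q.2‖ := norm_sum_le _ _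
    _ ≤ ∑ p ∈ Nat.divisorsAntidiagonal n, M * (n : ℝ) ^ 3 := Finset.sum_le_sum hterm
    _ = ((Nat.divisorsAntidiagonal n).card : ℝ) * (M * (n : ℝ) ^ 3) := by rw [Finset.sum_const, nsmul_eq_mul]
    _ ≤ (n : ℝ) * (M * (n : ℝ) ^ 3) := mul_le_mul_of_nonneg_right (hcardA n) (by positivity)
    _ = M * (n : ℝ) ^ 4 := by ring

/-- The tiny datum of the divisor class: `|a₂(n)| ≤ B·τ(n) ≤ B·n`. [cite: Zhang2022LandauSiegel, §3 (3.1)] -/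
theorem lemma81Dil_norm_tiny_le {a₂ : ℕ → ℂ} {B : ℝ} (ha₂ : ∀ n, ‖a₂ n‖ ≤ B * ((Nat.divisors n).card : ℝ))
    (n : ℕ) : ‖a₂ n‖ ≤ B * (n : ℝ) := by
  have hB : 0 ≤ B := by
    have h := ha₂ 1
    simp only [Nat.divisors_one, Finset.card_singleton, Nat.cast_one, mul_one] at h
    exact (norm_nonneg _).trans h
  exact (ha₂ n).trans (mul_le_mul_of_nonneg_left (by exact_mod_cast Nat.card_divisors_le_self n) hB)

/-- **The truncations and sizes are inside the generic theorem's range for large `D`**: with `𝓛 ≥ |B| + 28`,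
`Nlong D ≤ P³`, `Nsupp D ≤ P³`, `D·B·n⁴ ≤ P¹⁰` for `n < Nlong D` and `B·n ≤ P¹⁰` for `n < Nsupp D`
(`Nlong = D⁵(⌊P⌋+1)² ≤ 4D⁵P²`, `Nsupp ≤ 2P`, `D = e^{𝓛}`, `P = e^{𝓛⁹}`). [cite: Zhang2022LandauSiegel, §2 (2.6); §7 (7.2)] -/
theorem lemma81Dil_sizes {B : ℝ} (hD : 1 ≤ D) (hℓ : |B| + 28 ≤ ell D) :
    ((Nlong D : ℕ) : ℝ) ≤ bigP D ^ 3 ∧ ((Nsupp D : ℕ) : ℝ) ≤ bigP D ^ 3 ∧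
      (∀ n : ℕ, n < Nlong D → (D : ℝ) * B * (n : ℝ) ^ 4 ≤ bigP D ^ 10) ∧
      (∀ n : ℕ, n < Nsupp D → B * (n : ℝ) ≤ bigP D ^ 10) := by
  have hB0 : 0 ≤ |B| := abs_nonneg B
  have hℓ28 : 28 ≤ ell D := by linarith
  have hℓ1 : 1 ≤ ell D := by linarith
  have hP : bigP D = Real.exp (ell D ^ 9) := rfl
  have hP0 : 0 < bigP D := Real.exp_pos _
  have hP1 : 1 ≤ bigP D := by rw [hP]; exact Real.one_le_exp (by positivity)
  have hDexp : (D : ℝ) = Real.exp (ell D) := by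
    rw [ell, Real.exp_log (by exact_mod_cast (by omega : 0 < D))]
  have hℓ9 : ell D ^ 2 ≤ ell D ^ 9 := pow_le_pow_right₀ hℓ1 (by norm_num)
  have hℓsq : 28 * ell D ≤ ell D ^ 2 := by nlinarith
  -- `4D⁵ ≤ P`, hence `Nlong ≤ 4D⁵P² ≤ P³`
  have hNsupp : ((Nsupp D : ℕ) : ℝ) ≤ 2 * bigP D := Sec18SjNorm.Nsupp_le_two_mul_bigP D
  have hfloor : ((⌊bigP D⌋₊ + 1 : ℕ) : ℝ) ≤ 2 * bigP D := by
    push_cast; linarith [Nat.floor_le hP0.le]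
  have hNlong : ((Nlong D : ℕ) : ℝ) ≤ 4 * (D : ℝ) ^ 5 * bigP D ^ 2 := by
    rw [Nlong]; push_cast
    calc (D : ℝ) ^ 5 * ((⌊bigP D⌋₊ : ℝ) + 1) ^ 2 ≤ (D : ℝ) ^ 5 * (2 * bigP D) ^ 2 := by
          gcongr; exact_mod_cast hfloor
      _ = 4 * (D : ℝ) ^ 5 * bigP D ^ 2 := by ring
  have h4D5 : 4 * (D : ℝ) ^ 5 ≤ bigP D := by
    rw [hDexp, ← Real.exp_nat_mul, hP]
    have h4 : (4 : ℝ) ≤ Real.exp 2 := by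
      have he : Real.exp 2 = Real.exp 1 * Real.exp 1 := by rw [← Real.exp_add]; norm_num
      have h1 : (2.7 : ℝ) < Real.exp 1 := by have := Real.exp_one_gt_d9; linarith
      rw [he]; nlinarith
    calc 4 * Real.exp ((5 : ℕ) * ell D) ≤ Real.exp 2 * Real.exp ((5 : ℕ) * ell D) := by gcongr
      _ = Real.exp (2 + 5 * ell D) := by rw [← Real.exp_add]; norm_num
      _ ≤ Real.exp (ell D ^ 9) := Real.exp_le_exp.mpr (by nlinarith)
  have hN1 : ((Nlong D : ℕ) : ℝ) ≤ bigP D ^ 3 := by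
    calc ((Nlong D : ℕ) : ℝ) ≤ 4 * (D : ℝ) ^ 5 * bigP D ^ 2 := hNlong
      _ ≤ bigP D * bigP D ^ 2 := by gcongr
      _ = bigP D ^ 3 := by ring
  have hN2 : ((Nsupp D : ℕ) : ℝ) ≤ bigP D ^ 3 := by
    calc ((Nsupp D : ℕ) : ℝ) ≤ 2 * bigP D := hNsupp
      _ ≤ bigP D ^ 2 * bigP D := by
          have h2 : (2 : ℝ) ≤ bigP D := by
            rw [hP]; have := Real.add_one_le_exp (ell D ^ 9); nlinarith [one_le_pow₀ (M₀ := ℝ) hℓ1 (n := 9)]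
          nlinarith [one_le_pow₀ (M₀ := ℝ) hP1 (n := 2)]
      _ = bigP D ^ 3 := by ring
  -- `256·|B|·D²¹ ≤ P²`
  have hBD : 256 * |B| * (D : ℝ) ^ 21 ≤ bigP D ^ 2 := by
    rw [hDexp, ← Real.exp_nat_mul, hP, ← Real.exp_nat_mul]
    have h256 : (256 : ℝ) ≤ Real.exp 6 := by
      have := Real.add_one_le_exp (6:ℝ)
      have h3 : Real.exp 6 = Real.exp 2 * Real.exp 2 * Real.exp 2 := by rw [← Real.exp_add, ← Real.exp_add]; norm_num
      have h2 : (7 : ℝ) ≤ Real.exp 2 := by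
        have he : Real.exp 2 = Real.exp 1 * Real.exp 1 := by rw [← Real.exp_add]; norm_num
        have h1 : (2.7 : ℝ) < Real.exp 1 := by have := Real.exp_one_gt_d9; linarith
        rw [he]; nlinarith
      rw [h3]; nlinarith [Real.exp_pos (2:ℝ)]
    have hBe : |B| ≤ Real.exp |B| := by linarith [Real.add_one_le_exp |B|]
    calc 256 * |B| * Real.exp ((21 : ℕ) * ell D) ≤ Real.exp 6 * Real.exp |B| * Real.exp ((21 : ℕ) * ell D) := by
          gcongr
      _ = Real.exp (6 + |B| + 21 * ell D) := by rw [← Real.exp_add, ← Real.exp_add]; norm_num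
      _ ≤ Real.exp ((2 : ℕ) * ell D ^ 9) := Real.exp_le_exp.mpr (by push_cast; nlinarith)
  refine ⟨hN1, hN2, fun n hn => ?_, fun n hn => ?_⟩
  · have hn' : (n : ℝ) ≤ 4 * (D : ℝ) ^ 5 * bigP D ^ 2 := (by exact_mod_cast hn.le : (n : ℝ) ≤ Nlong D).trans hNlong
    have hB' : B ≤ |B| := le_abs_self B
    calc (D : ℝ) * B * (n : ℝ) ^ 4 ≤ (D : ℝ) * |B| * (4 * (D : ℝ) ^ 5 * bigP D ^ 2) ^ 4 := by
          have hD0 : (0 : ℝ) ≤ D := Nat.cast_nonneg _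
          have h1 : (D : ℝ) * B * (n : ℝ) ^ 4 ≤ (D : ℝ) * |B| * (n : ℝ) ^ 4 := by gcongr
          exact h1.trans (by gcongr)
      _ = (256 * |B| * (D : ℝ) ^ 21) * bigP D ^ 8 := by ring
      _ ≤ bigP D ^ 2 * bigP D ^ 8 := by gcongr
      _ = bigP D ^ 10 := by ring
  · have hn' : (n : ℝ) ≤ 2 * bigP D := (by exact_mod_cast hn.le : (n : ℝ) ≤ Nsupp D).trans hNsupp
    have hD1 : (1 : ℝ) ≤ (D : ℝ) ^ 21 := one_le_pow₀ (by exact_mod_cast hD)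
    calc B * (n : ℝ) ≤ |B| * (2 * bigP D) := by
          exact (mul_le_mul_of_nonneg_right (le_abs_self B) (Nat.cast_nonneg n)).trans (by gcongr)
      _ ≤ (256 * |B| * (D : ℝ) ^ 21) * bigP D ^ 8 := by
          have h8 : bigP D ≤ bigP D ^ 8 := le_self_pow₀ hP1 (by norm_num)
          have h2 : 2 * bigP D ≤ (256 * (D : ℝ) ^ 21) * bigP D ^ 8 :=
            mul_le_mul (by nlinarith) h8 hP0.le (by positivity)
          calc |B| * (2 * bigP D) ≤ |B| * ((256 * (D : ℝ) ^ 21) * bigP D ^ 8) :=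
                mul_le_mul_of_nonneg_left h2 hB0
            _ = (256 * |B| * (D : ℝ) ^ 21) * bigP D ^ 8 := by ring
      _ ≤ bigP D ^ 2 * bigP D ^ 8 := by gcongr
      _ = bigP D ^ 10 := by ring

end Sizes

/-! ### The slot reduced to its mean square -/

/-- **P2-Dil POINTWISE IN THE DATA, MODULO THE u014 MEAN SQUARE.** There is `c₀` such that for every `c′ ≥ c₀`, every
class constant `B` and every `ε > 0` there is `K > 0` with: for all large `D`, under (A), for every head `b₀` with
`|b₀(n)| ≤ Bτ(n)²`, in-class sup-normalised pieces `g, f`, and tiny datum `|a₂(n)| ≤ Bτ(n)`, IF the two mean squares of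
`A_{Nlong}(𝐚₁;s)A_{Nsupp}(a₂;1−s)` and of its reflection over `Ψ₁` are `≤ K·D·P²·𝓛³⁸` along `𝔍(α)`
(`𝐚₁ = longPsiData χ (dilHead D b₀) g f`), THEN the conclusion of `Lemma81LongPsiDil c′` holds at this datum:
`‖lhs81Ext − (Theta1Ext + conj Theta1Ext′)‖ ≤ ε·√D·𝔓`. (`lemma81Ext_of_meanSquare_eventually` at `N₁ = Nlong D`,
`N₂ = Nsupp D`; `C𝓛⁻⁹⁶P√(KDP²𝓛³⁸) = C√K·√D·P²𝓛⁻⁷⁷ ≤ 2C√K·√D·𝔓` by (2.9).) The supports `≤ D⁴` and the shortness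
`θg + θf ≤ 2 − δ` of the slot are not used here — they matter only for the mean square.
[cite: Zhang2022LandauSiegel, §8 Lemma 8.1 pp. 42–44; §2 (2.9)] -/
theorem lemma81LongPsiDil_pointwise_of_meanSquare :
    ∃ c₀ : ℝ, ∀ c' : ℝ, c₀ ≤ c' → ∀ B ε : ℝ, 0 < ε → ∃ K : ℝ, 0 < K ∧
      ForAllLarge fun D _ χ => AssumptionA D χ →
        ∀ (b₀ : ℕ → ℂ) (g g' f f' : ℝ → ℂ) (a₂ : ℕ → ℂ),
          InClassPiece g g' → InClassPiece f f' →
          (∀ x ∈ Set.Icc (0:ℝ) 1, ‖g x‖ ≤ 1) → (∀ x ∈ Set.Icc (0:ℝ) 1, ‖f x‖ ≤ 1) →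
          (∀ n, ‖b₀ n‖ ≤ B * ((Nat.divisors n).card : ℝ) ^ 2) →
          (∀ n, ‖a₂ n‖ ≤ B * ((Nat.divisors n).card : ℝ)) →
          (∀ v ∈ Set.Icc (-ell1 D) (ell1 D), ∑ x ∈ finsetOf (PsiOne χ),
              ‖Lemma81.dirPoly (Nlong D) (longPsiData χ (dilHead D b₀) g f) x.ψ (((alpha D : ℝ) : ℂ) + s0 D + v * I) *
                  Lemma81.dirPoly (Nsupp D) a₂ x.ψ⁻¹ (1 - (((alpha D : ℝ) : ℂ) + s0 D + v * I))‖ ^ 2 ≤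
                K * D * bigP D ^ 2 * ell D ^ 38) →
          (∀ v ∈ Set.Icc (-ell1 D) (ell1 D), ∑ x ∈ finsetOf (PsiOne χ),
              ‖Lemma81.dirPoly (Nsupp D) (fun n => conj (a₂ n)) x.ψ (((alpha D : ℝ) : ℂ) + s0 D + v * I) *
                  Lemma81.dirPoly (Nlong D) (fun n => conj (longPsiData χ (dilHead D b₀) g f n)) x.ψ⁻¹
                    (1 - (((alpha D : ℝ) : ℂ) + s0 D + v * I))‖ ^ 2 ≤ K * D * bigP D ^ 2 * ell D ^ 38) →
          ‖lhs81Ext c' χ (Nlong D) (Nsupp D) (longPsiData χ (dilHead D b₀) g f) a₂ -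
              (Theta1Ext c' χ (Nlong D) (Nsupp D) (longPsiData χ (dilHead D b₀) g f) a₂ +
                conj (Theta1Ext c' χ (Nsupp D) (Nlong D) (fun n => conj (a₂ n))
                  (fun n => conj (longPsiData χ (dilHead D b₀) g f n))))‖
            ≤ ε * Real.sqrt D * frakP D := by
  obtain ⟨c₀, -, hgen⟩ := lemma81Ext_of_meanSquare_eventually
  refine ⟨c₀, fun c' hc' B ε hε => ?_⟩
  obtain ⟨C, Dg, hg⟩ := hgen c' hc'
  set k : ℝ := ε / (4 * (|C| + 1)) with hk
  have hk0 : 0 < k := by rw [hk]; positivity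
  refine ⟨k ^ 2, by positivity, ?_⟩
  obtain ⟨D₁, hD₁⟩ := Ded81Edge.exists_frakP_ge_half
  obtain ⟨D₂, hD₂⟩ := Skeleton.exists_nat_forall_le_ell (|B| + 28)
  obtain ⟨D₃, hD₃⟩ := Ded81Edge.exists_two_le_frakP
  refine ⟨max (max Dg D₁) (max (max D₂ D₃) (⌈(1 / ε) ^ 2⌉₊ + 1)), ?_⟩
  intro D _ χ hD hq hp hA b₀ g g' f f' a₂ hgc hfc hg1 hf1 hb₀ ha₂ hMS1 hMS2
  have hDg : Dg ≤ D := le_trans (le_trans (le_max_left _ _) (le_max_left _ _)) hD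
  have hD1 := hD₁ D (le_trans (le_trans (le_max_right _ _) (le_max_left _ _)) hD)
  have hℓ := hD₂ D (le_trans (le_trans (le_trans (le_max_left _ _) (le_max_left _ _)) (le_max_right _ _)) hD)
  have h𝔓2 := hD₃ D (le_trans (le_trans (le_trans (le_max_right _ _) (le_max_left _ _)) (le_max_right _ _)) hD)
  have hDε : ⌈(1 / ε) ^ 2⌉₊ + 1 ≤ D := le_trans (le_trans (le_max_right _ _) (le_max_right _ _)) hD
  have hD1' : 1 ≤ D := le_trans (Nat.le_add_left 1 _) hDε
  have hℓ1 : 1 ≤ ell D := by linarith [abs_nonneg B]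
  -- sizes
  obtain ⟨hN1, hN2, hsz1, hsz2⟩ := lemma81Dil_sizes (B := B) hD1' hℓ
  have hB : 0 ≤ B := by
    have h := ha₂ 1
    simp only [Nat.divisors_one, Finset.card_singleton, Nat.cast_one, mul_one] at h
    exact (norm_nonneg _).trans h
  have hlogP : 0 < Real.log (bigP D) := by rw [bigP, Real.log_exp]; positivity
  have ha₁' : ∀ n, n < Nlong D → ‖longPsiData χ (dilHead D b₀) g f n‖ ≤ bigP D ^ 10 := fun n hn =>
    (lemma81Dil_norm_longPsiData_le χ (M := (D : ℝ) * B) (by positivity) (lemma81Dil_norm_dilHead_le hb₀)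
      (lemma81Dil_norm_profData_le_one χ hlogP hgc hg1) (lemma81Dil_norm_profData_le_one χ hlogP hfc hf1) n).trans
      (hsz1 n hn)
  have ha₂' : ∀ n, n < Nsupp D → ‖a₂ n‖ ≤ bigP D ^ 10 := fun n hn =>
    (lemma81Dil_norm_tiny_le ha₂ n).trans (hsz2 n hn)
  have key := hg D χ hDg hq hp hA (Nlong D) (Nsupp D) (longPsiData χ (dilHead D b₀) g f) a₂
    (k ^ 2 * D * bigP D ^ 2 * ell D ^ 38) hN1 hN2 ha₁' ha₂' hMS1 hMS2
  refine key.trans ?_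
  -- the budget: `C𝓛⁻⁹⁶P·√(k²DP²𝓛³⁸) = Ck·√D·P²𝓛⁻⁷⁷ ≤ 2|C|k·√D·𝔓 ≤ (ε/2)√D𝔓`, `1 ≤ (ε/2)√D𝔓`
  have hP0 : 0 < bigP D := Real.exp_pos _
  have hℓ0 : 0 < ell D := by linarith
  have hD0 : (0 : ℝ) ≤ D := Nat.cast_nonneg _
  have hsqrt : Real.sqrt (k ^ 2 * D * bigP D ^ 2 * ell D ^ 38) = k * bigP D * ell D ^ 19 * Real.sqrt D := by
    have e : k ^ 2 * (D : ℝ) * bigP D ^ 2 * ell D ^ 38 = (k * bigP D * ell D ^ 19) ^ 2 * D := by ring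
    rw [e, Real.sqrt_mul (sq_nonneg _), Real.sqrt_sq (by positivity)]
  have hM : Real.exp (ell D ^ 9) ^ 2 * (ell D ^ 77)⁻¹ = bigP D ^ 2 * (ell D ^ 77)⁻¹ := by rw [bigP]
  rw [hM] at hD1
  have hmain : C * ((ell D ^ 96)⁻¹ * bigP D) * Real.sqrt (k ^ 2 * D * bigP D ^ 2 * ell D ^ 38) ≤
      ε / 2 * Real.sqrt D * frakP D := by
    rw [hsqrt]
    have e : C * ((ell D ^ 96)⁻¹ * bigP D) * (k * bigP D * ell D ^ 19 * Real.sqrt D) =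
        C * k * (bigP D ^ 2 * (ell D ^ 77)⁻¹) * Real.sqrt D := by
      field_simp
    rw [e]
    have h1 : C * k * (bigP D ^ 2 * (ell D ^ 77)⁻¹) * Real.sqrt D ≤ |C| * k * (2 * frakP D) * Real.sqrt D := by
      have hX : 0 ≤ bigP D ^ 2 * (ell D ^ 77)⁻¹ := by positivity
      have h2 : bigP D ^ 2 * (ell D ^ 77)⁻¹ ≤ 2 * frakP D := by linarith
      calc C * k * (bigP D ^ 2 * (ell D ^ 77)⁻¹) * Real.sqrt D
          ≤ |C| * k * (bigP D ^ 2 * (ell D ^ 77)⁻¹) * Real.sqrt D := by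
            gcongr; exact le_abs_self C
        _ ≤ |C| * k * (2 * frakP D) * Real.sqrt D := by gcongr
    have h3 : |C| * k * 2 ≤ ε / 2 := by
      rw [hk]
      have hC1 : 0 < |C| + 1 := by positivity
      rw [show |C| * (ε / (4 * (|C| + 1))) * 2 = ε / 2 * (|C| / (|C| + 1)) by field_simp; ring]
      have : |C| / (|C| + 1) ≤ 1 := by rw [div_le_one hC1]; linarith
      nlinarith
    have h𝔓0 : 0 ≤ frakP D := by linarith
    calc C * k * (bigP D ^ 2 * (ell D ^ 77)⁻¹) * Real.sqrt D ≤ |C| * k * (2 * frakP D) * Real.sqrt D := h1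
      _ = (|C| * k * 2) * (Real.sqrt D * frakP D) := by ring
      _ ≤ ε / 2 * (Real.sqrt D * frakP D) :=
          mul_le_mul_of_nonneg_right h3 (mul_nonneg (Real.sqrt_nonneg _) h𝔓0)
      _ = ε / 2 * Real.sqrt D * frakP D := by ring
  have hone : (1 : ℝ) ≤ ε / 2 * Real.sqrt D * frakP D := by
    have hDε' : (1 / ε) ^ 2 ≤ (D : ℝ) := by
      have h1 : ((⌈(1 / ε) ^ 2⌉₊ : ℕ) : ℝ) + 1 ≤ D := by exact_mod_cast hDε
      linarith [Nat.le_ceil ((1 / ε) ^ 2)]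
    have hsD : 1 / ε ≤ Real.sqrt D := Real.le_sqrt_of_sq_le hDε'
    have h1 : (1 : ℝ) = ε / 2 * (1 / ε) * 2 := by field_simp
    rw [h1]
    have hε2 : 0 ≤ ε / 2 := by positivity
    exact mul_le_mul (mul_le_mul_of_nonneg_left hsD hε2) h𝔓2 (by norm_num)
      (mul_nonneg hε2 (Real.sqrt_nonneg _))
  linarith

/-- **STUB 3 (`stub_lemma81LongPsiDil`) REDUCED TO THE CLASS MEAN SQUARE**: the registered signature
`∃ c₀ ∀ c′ ≥ c₀, LongLegSplit.Lemma81LongPsiDil c′` follows from the `o(D·P²·𝓛³⁸)` mean square of the slot's product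
polynomial over its class (both orders), quantified exactly like the slot. This is what remains of P2-Dil after the
generic chain; for the divisor class AS TYPED the hypothesis is out of reach of Lemma 3.3 (ii) (its worst-case order is
`≍ D·P²·𝓛⁹⁶`, memo §3) — the line's stub 3 is MISSTATED at the class, and the (A)-lacunary cell heads are the repair.
[cite: Zhang2022LandauSiegel, §8 Lemma 8.1 pp. 42–44; §3 Lemma 3.3] -/
theorem lemma81LongPsiDil_of_meanSquare
    (hMS : ∀ δ : ℝ, 0 < δ → ∀ B : ℝ, ∀ K : ℝ, 0 < K → ForAllLarge fun D _ χ => AssumptionA D χ →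
      ∀ (b₀ : ℕ → ℂ) (g g' f f' : ℝ → ℂ) (a₂ : ℕ → ℂ) (θg θf : ℝ),
        ShortPiece θg g g' → ShortPiece θf f f' → θg + θf ≤ 2 - δ →
        (∀ x ∈ Set.Icc (0:ℝ) 1, ‖g x‖ ≤ 1) → (∀ x ∈ Set.Icc (0:ℝ) 1, ‖f x‖ ≤ 1) →
        (∀ n, ‖b₀ n‖ ≤ B * ((Nat.divisors n).card : ℝ) ^ 2) → (∀ n : ℕ, D ^ 4 < n → b₀ n = 0) →
        (∀ n, ‖a₂ n‖ ≤ B * ((Nat.divisors n).card : ℝ)) → (∀ n : ℕ, D ^ 4 < n → a₂ n = 0) →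
        ∀ v ∈ Set.Icc (-ell1 D) (ell1 D),
          (∑ x ∈ finsetOf (PsiOne χ),
              ‖Lemma81.dirPoly (Nlong D) (longPsiData χ (dilHead D b₀) g f) x.ψ (((alpha D : ℝ) : ℂ) + s0 D + v * I) *
                  Lemma81.dirPoly (Nsupp D) a₂ x.ψ⁻¹ (1 - (((alpha D : ℝ) : ℂ) + s0 D + v * I))‖ ^ 2 ≤
            K * D * bigP D ^ 2 * ell D ^ 38) ∧
          (∑ x ∈ finsetOf (PsiOne χ),
              ‖Lemma81.dirPoly (Nsupp D) (fun n => conj (a₂ n)) x.ψ (((alpha D : ℝ) : ℂ) + s0 D + v * I) *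
                  Lemma81.dirPoly (Nlong D) (fun n => conj (longPsiData χ (dilHead D b₀) g f n)) x.ψ⁻¹
                    (1 - (((alpha D : ℝ) : ℂ) + s0 D + v * I))‖ ^ 2 ≤ K * D * bigP D ^ 2 * ell D ^ 38)) :
    ∃ c₀ : ℝ, ∀ c' : ℝ, c₀ ≤ c' → LongLegSplit.Lemma81LongPsiDil c' := by
  obtain ⟨c₀, h⟩ := lemma81LongPsiDil_pointwise_of_meanSquare
  refine ⟨c₀, fun c' hc' => ?_⟩
  intro δ hδ B ε hε
  obtain ⟨K, hK, hpt⟩ := h c' hc' B ε hε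
  refine ((hpt.and (hMS δ hδ B K hK)).mono ?_)
  intro D _ χ _ _ hS hA b₀ g g' f f' a₂ θg θf hsg hsf hθ hg1 hf1 hb₀ hb₀0 ha₂ ha₂0
  obtain ⟨h1, h2⟩ := hS
  exact h1 hA b₀ g g' f f' a₂ hsg.inClass hsf.inClass hg1 hf1 hb₀ ha₂
    (fun v hv => (h2 hA b₀ g g' f f' a₂ θg θf hsg hsf hθ hg1 hf1 hb₀ hb₀0 ha₂ ha₂0 v hv).1)
    (fun v hv => (h2 hA b₀ g g' f f' a₂ θg θf hsg hsf hθ hg1 hf1 hb₀ hb₀0 ha₂ ha₂0 v hv).2)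

end Summit.Parity.GeneralizedHardyLittlewood.Theorems

end
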